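import Summits.Ventures.Crystal3D.Theorems.StickyWulffConstantCoaxialWallLawReducedWordRigidity
import HarnessLib

/-!
# (D4′) CLASS COLLAPSE: on the two standard dozens, the admissible classes of ANY plate system are the root classes
# of ONE standard frame and their basal partners (crux `CoaxialWallLaw`, stmt-Ventures-19481, line `WallLedgerF`)

HONEST FRAMING. Venture `Summits/Ventures/Crystal3D` (cell `crystal3d-full`), helper `--supports` the crux
`CoaxialWallLaw` of `route-Ventures-StickyWulffConstant` (REGISTERED line `WallLedgerF`, planner cf-p1).  Rung credit;
F-C1 not moved; census-free, no kissing facts.  cf-p1 ORDER OF RECORD for 19481-p2 g8 (2026-08-28T21:28:15Z) item (2),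
lemma (D4′) («depth lemma»), in the sharper form announced in the PREREG-F-CERT signature (INBOX 21:58Z): not «depth
≤ D» but a complete description of the admissible classes `(S.Fw κ, d)` of an ARBITRARY plate system `S = ⟨L′, RT⟩`
whose frame has one of the two STANDARD slot dozens `D₊ = fccSlots`, `D₋ = basalMirror '' fccSlots` — by the frame
lemma (`…BarlowWindowFrames`) these are the only classes that can carry a mover on a Barlow window.

* **`class_collapse`** — for every plate system `S` there are ONE frame `F` with a standard dozen and ONE sign `σ = ±1`
  such that every well-formed class `κ` of every root `r` whose frame `S.Fw κ` has a standard dozen is EITHER the node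
  `(img F, σ F r)` OR its BASAL PARTNER `(M_b '' img F, −M_b (σ F r))`, the latter only for roots with `(F r)₂ ≠ 0`
  (proof: a class `κ₀` of minimal length with a standard dozen; `F := S.Fw κ₀`, `σ := (−1)^{|κ₀|}`; any other standard
  class has the dozen of `κ₀` or of `n :: κ₀`, so by reduced-word rigidity it IS `κ₀` or `n :: κ₀` letterwise — the
  degenerate case `n = ±head κ₀` would be a shorter standard class);
* **`twin_collapse`** — if BOTH the system `⟨L′, R₁⟩` and its half-turn companion `⟨H ≫ L′, R₂⟩` have a standard class
  over basal roots, then both classes are ROOT classes, `L′` itself is standard and `L′ e₃ = ±e₃` (the companion's class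
  `κ` reads the word `κ ++ [e₃]`, `image_fw_halfTurn`, and no chain over a basal root contains the letter `±e₃`).
READING: with the frame lemma, the (A)-statistic of the typed rows at an on-site window is dominated, frame by frame,
by ONE of the `20` signature rows of `…EndRowOnSiteDefsA` (the bridge file does the bookkeeping); numerically the class
graph was checked to depth 7 in exact arithmetic (HOME/wall-19481-p2/g8-classgraph.py).
WHAT THIS IS NOT: not the on-site fact, not the tail; F-C1 not moved.
-/

noncomputable section

namespace Summit.Ventures.Crystal3D.Theorems

open Summit.Ventures.Crystal3D Finset
open Literature.MathematicalPhysics.StatisticalMechanics (basalMirror basalMirror_apply_coord basalMirror_basalMirror)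
open scoped InnerProductSpace

/-! ### The collapse -/

section Collapse

/-- The pulled-back axis of a STANDARD frame is a unit model menu normal. -/
theorem symm_axis_menu {G : EuclideanSpace ℝ (Fin 3) ≃ₗᵢ[ℝ] EuclideanSpace ℝ (Fin 3)}
    (hG : (G : EuclideanSpace ℝ (Fin 3) → EuclideanSpace ℝ (Fin 3)) '' ↑fccSlots = ↑fccSlots ∨
      (G : EuclideanSpace ℝ (Fin 3) → EuclideanSpace ℝ (Fin 3)) '' ↑fccSlots =
        (basalMirror : EuclideanSpace ℝ (Fin 3) → EuclideanSpace ℝ (Fin 3)) '' ↑fccSlots) :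
    ‖G.symm (EuclideanSpace.single (2 : Fin 3) (1 : ℝ))‖ = 1 ∧
      ∀ w ∈ fccSlots, ⟪w, G.symm (EuclideanSpace.single (2 : Fin 3) (1 : ℝ))⟫_ℝ = 0 ∨
        ⟪w, G.symm (EuclideanSpace.single (2 : Fin 3) (1 : ℝ))⟫_ℝ = Real.sqrt (2 / 3) ∨
        ⟪w, G.symm (EuclideanSpace.single (2 : Fin 3) (1 : ℝ))⟫_ℝ = -Real.sqrt (2 / 3) := by
  refine ⟨norm_symm_axis G, fun w hw => ?_⟩
  rw [← LinearIsometryEquiv.inner_map_map G, LinearIsometryEquiv.apply_symm_apply, inner_single_two_one]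
  have hmem : G w ∈ (G : EuclideanSpace ℝ (Fin 3) → EuclideanSpace ℝ (Fin 3)) '' ↑fccSlots :=
    Set.mem_image_of_mem _ (mem_coe.2 hw)
  rcases hG with hG | hG
  · rw [hG] at hmem
    exact slot_apply_two_cases (mem_coe.1 hmem)
  · rw [hG] at hmem
    obtain ⟨w', hw', heq⟩ := hmem
    rw [← heq, basalMirror_apply_coord]
    simp only [if_true]
    rcases slot_apply_two_cases (mem_coe.1 hw') with h | h | h
    · exact Or.inl (by rw [h, neg_zero])
    · exact Or.inr (Or.inr (by rw [h]))
    · exact Or.inr (Or.inl (by rw [h, neg_neg]))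

/-- The two coordinate facts used below: `⟪r, G⁻¹e₃⟫ = (G r)₂`. -/
theorem inner_symm_axis (G : EuclideanSpace ℝ (Fin 3) ≃ₗᵢ[ℝ] EuclideanSpace ℝ (Fin 3)) (r : EuclideanSpace ℝ (Fin 3)) :
    ⟪r, G.symm (EuclideanSpace.single (2 : Fin 3) (1 : ℝ))⟫_ℝ = (G r) 2 := by
  rw [← LinearIsometryEquiv.inner_map_map G, LinearIsometryEquiv.apply_symm_apply, inner_single_two_one]

/-- From `Forall₂` on a cons: the heads are `±`-equal and the tails are related. -/
theorem forall₂_cons_right {κ : List (EuclideanSpace ℝ (Fin 3))} {n : EuclideanSpace ℝ (Fin 3)}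
    {κ₀ : List (EuclideanSpace ℝ (Fin 3))} (h : List.Forall₂ (fun a b => a = b ∨ a = -b) κ (n :: κ₀)) :
    ∃ μ κ', κ = μ :: κ' ∧ (μ = n ∨ μ = -n) ∧ List.Forall₂ (fun a b => a = b ∨ a = -b) κ' κ₀ := by
  cases κ with
  | nil => exact absurd h (by intro h'; cases h')
  | cons μ κ' =>
    rw [List.forall₂_cons] at h
    exact ⟨μ, κ', rfl, h.1, h.2⟩

open scoped Classical in
/-- **CLASS COLLAPSE.**  For every plate system there are a frame `F` with a standard dozen and a sign
`σ = ±1` such that every well-formed class of every root whose frame has a standard dozen is the node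
`(img F, σ F r)` or its basal partner `(M_b '' img F, −M_b (σ F r))` (the latter only if `(F r)₂ ≠ 0`). -/
theorem class_collapse (S : PlateSystem) :
    ∃ (F : EuclideanSpace ℝ (Fin 3) ≃ₗᵢ[ℝ] EuclideanSpace ℝ (Fin 3)) (σ : ℝ), (σ = 1 ∨ σ = -1) ∧
      ((F : EuclideanSpace ℝ (Fin 3) → EuclideanSpace ℝ (Fin 3)) '' ↑fccSlots = ↑fccSlots ∨
        (F : EuclideanSpace ℝ (Fin 3) → EuclideanSpace ℝ (Fin 3)) '' ↑fccSlots =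
          (basalMirror : EuclideanSpace ℝ (Fin 3) → EuclideanSpace ℝ (Fin 3)) '' ↑fccSlots) ∧
      ∀ r ∈ S.RT, ∀ κ : List (EuclideanSpace ℝ (Fin 3)), WFChain r κ →
        ((S.Fw κ : EuclideanSpace ℝ (Fin 3) → EuclideanSpace ℝ (Fin 3)) '' ↑fccSlots = ↑fccSlots ∨
          (S.Fw κ : EuclideanSpace ℝ (Fin 3) → EuclideanSpace ℝ (Fin 3)) '' ↑fccSlots =
            (basalMirror : EuclideanSpace ℝ (Fin 3) → EuclideanSpace ℝ (Fin 3)) '' ↑fccSlots) →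
        ((S.Fw κ : EuclideanSpace ℝ (Fin 3) → EuclideanSpace ℝ (Fin 3)) '' ↑fccSlots =
            (F : EuclideanSpace ℝ (Fin 3) → EuclideanSpace ℝ (Fin 3)) '' ↑fccSlots ∧
          S.Fw κ (((-1 : ℝ) ^ κ.length) • r) = σ • F r) ∨
        ((S.Fw κ : EuclideanSpace ℝ (Fin 3) → EuclideanSpace ℝ (Fin 3)) '' ↑fccSlots =
            (basalMirror : EuclideanSpace ℝ (Fin 3) → EuclideanSpace ℝ (Fin 3)) ''
              ((F : EuclideanSpace ℝ (Fin 3) → EuclideanSpace ℝ (Fin 3)) '' ↑fccSlots) ∧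
          S.Fw κ (((-1 : ℝ) ^ κ.length) • r) = -basalMirror (σ • F r) ∧ (F r) 2 ≠ 0) := by
  by_cases hex : ∃ k : ℕ, ∃ r ∈ S.RT, ∃ κ : List (EuclideanSpace ℝ (Fin 3)), κ.length = k ∧ WFChain r κ ∧
      ((S.Fw κ : EuclideanSpace ℝ (Fin 3) → EuclideanSpace ℝ (Fin 3)) '' ↑fccSlots = ↑fccSlots ∨
        (S.Fw κ : EuclideanSpace ℝ (Fin 3) → EuclideanSpace ℝ (Fin 3)) '' ↑fccSlots =
          (basalMirror : EuclideanSpace ℝ (Fin 3) → EuclideanSpace ℝ (Fin 3)) '' ↑fccSlots)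
  swap
  · -- no standard class at all: the statement is vacuous
    refine ⟨LinearIsometryEquiv.refl ℝ _, 1, Or.inl rfl, Or.inl (by simp), ?_⟩
    intro r hr κ hκ hstd
    exact absurd ⟨κ.length, r, hr, κ, rfl, hκ, hstd⟩ hex
  -- a standard class `κ₀` of minimal length
  obtain ⟨r₀, hr₀, κ₀, hlen, hκ₀, hstd₀⟩ := Nat.find_spec hex
  have hmin : ∀ k < Nat.find hex, ¬ ∃ r ∈ S.RT, ∃ κ : List (EuclideanSpace ℝ (Fin 3)), κ.length = k ∧ WFChain r κ ∧
      ((S.Fw κ : EuclideanSpace ℝ (Fin 3) → EuclideanSpace ℝ (Fin 3)) '' ↑fccSlots = ↑fccSlots ∨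
        (S.Fw κ : EuclideanSpace ℝ (Fin 3) → EuclideanSpace ℝ (Fin 3)) '' ↑fccSlots =
          (basalMirror : EuclideanSpace ℝ (Fin 3) → EuclideanSpace ℝ (Fin 3)) '' ↑fccSlots) :=
    fun k hk => Nat.find_min hex hk
  obtain ⟨hlet₀, hch₀⟩ := wfChain_letters hκ₀
  have hunit₀ : ∀ μ ∈ κ₀, ‖μ‖ = 1 := fun μ hμ => (hlet₀ μ hμ).1
  set F := S.Fw κ₀ with hF
  set n : EuclideanSpace ℝ (Fin 3) := F.symm (EuclideanSpace.single (2 : Fin 3) (1 : ℝ)) with hn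
  have hnm := symm_axis_menu hstd₀
  refine ⟨F, (-1 : ℝ) ^ κ₀.length, neg_one_pow_eq_or ℝ κ₀.length, hstd₀, ?_⟩
  intro r hr κ hκ hstd
  obtain ⟨hlet, hch⟩ := wfChain_letters hκ
  have hunit : ∀ μ ∈ κ, ‖μ‖ = 1 := fun μ hμ => (hlet μ hμ).1
  rcases std_cases hstd₀ hstd with hI | hII
  · -- type I: the class has the dozen of `κ₀`, hence IS `κ₀` up to letter signs
    left
    have hF2 := reduced_forall₂_of_foldl_image_eq κ κ₀ hlet hlet₀ hch hch₀
      (foldl_image_eq_of_image_fw_eq S hunit hunit₀ hI)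
    refine ⟨hI, ?_⟩
    rw [fw_eq_of_forall₂ S hF2 hunit hunit₀, hF2.length_eq, LinearIsometryEquiv.map_smul]
  · -- type II: the class has the dozen of the basal partner `n :: κ₀`
    rw [hF, image_basalMirror_fw S κ₀] at hII
    have hletn : ∀ μ ∈ n :: κ₀, ‖μ‖ = 1 ∧
        ∀ w ∈ fccSlots, ⟪w, μ⟫_ℝ = 0 ∨ ⟪w, μ⟫_ℝ = Real.sqrt (2 / 3) ∨ ⟪w, μ⟫_ℝ = -Real.sqrt (2 / 3) := by
      intro μ hμ
      rcases List.mem_cons.1 hμ with rfl | hμ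
      · exact hnm
      · exact hlet₀ μ hμ
    have hunitn : ∀ μ ∈ n :: κ₀, ‖μ‖ = 1 := fun μ hμ => (hletn μ hμ).1
    by_cases hdeg : ∃ μ, κ₀.head? = some μ ∧ (n = μ ∨ n = -μ)
    · -- degenerate: `n` cancels the head of `κ₀`, and `κ` would be a SHORTER standard class
      exfalso
      obtain ⟨μ, hμ, hsign⟩ := hdeg
      obtain ⟨κ₀', rfl⟩ : ∃ κ₀', κ₀ = μ :: κ₀' := by
        cases κ₀ with
        | nil => simp at hμ
        | cons a l => simp at hμ; exact ⟨l, by rw [hμ]⟩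
      have hμ1 : ‖μ‖ = 1 := hunit₀ μ (by simp)
      rw [fw_cons_cons_of_sign S κ₀' hsign hμ1] at hII
      have hlet₀' : ∀ ν ∈ κ₀', ‖ν‖ = 1 ∧
          ∀ w ∈ fccSlots, ⟪w, ν⟫_ℝ = 0 ∨ ⟪w, ν⟫_ℝ = Real.sqrt (2 / 3) ∨ ⟪w, ν⟫_ℝ = -Real.sqrt (2 / 3) :=
        fun ν hν => hlet₀ ν (by simp [hν])
      have hunit₀' : ∀ ν ∈ κ₀', ‖ν‖ = 1 := fun ν hν => (hlet₀' ν hν).1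
      have hch₀' : List.IsChain (fun μ μ' => ⟪μ, μ'⟫_ℝ = 1 / 3 ∨ ⟪μ, μ'⟫_ℝ = -1 / 3) κ₀' := by
        rw [List.isChain_cons] at hch₀; exact hch₀.2
      have hF2 := reduced_forall₂_of_foldl_image_eq κ κ₀' hlet hlet₀' hch hch₀'
        (foldl_image_eq_of_image_fw_eq S hunit hunit₀' hII)
      have hlt : κ.length < Nat.find hex := by
        rw [hF2.length_eq, ← hlen, List.length_cons]; exact Nat.lt_succ_self _
      exact hmin κ.length hlt ⟨r, hr, κ, rfl, hκ, hstd⟩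
    · -- reduced: `κ` IS `n :: κ₀` up to letter signs
      right
      push Not at hdeg
      have hchn : List.IsChain (fun μ μ' => ⟪μ, μ'⟫_ℝ = 1 / 3 ∨ ⟪μ, μ'⟫_ℝ = -1 / 3) (n :: κ₀) :=
        isChain_cons_of_ne hnm hlet₀ hch₀ fun μ hμ => hdeg μ hμ
      have hF2 := reduced_forall₂_of_foldl_image_eq κ (n :: κ₀) hlet hletn hch hchn
        (foldl_image_eq_of_image_fw_eq S hunit hunitn hII)
      obtain ⟨μ, κ', rfl, hμn, hF2'⟩ := forall₂_cons_right hF2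
      refine ⟨by rw [hII, ← image_basalMirror_fw S κ₀], ?_, ?_⟩
      · -- the direction is the basal partner direction
        rw [fw_eq_of_forall₂ S hF2 hunit hunitn, word_F_cons_apply (PlateSystem.fw_cons S) hnm.1, ← hn,
          ← basalMirror_map, List.length_cons, hF2'.length_eq, pow_succ, LinearIsometryEquiv.map_smul,
          LinearIsometryEquiv.map_smul]
        rw [mul_neg_one, neg_smul, LinearIsometryEquiv.map_smul]
      · -- the root crosses the basal plane of `F`
        have hwf := (PlateSystem.wfChain_cons r μ κ').1 hκ
        obtain ⟨-, -, -, hcross, -⟩ := hwf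
        have hr : 0 < Real.sqrt (2 / 3) := Real.sqrt_pos.2 (by norm_num)
        intro h0
        have hrn : ⟪r, n⟫_ℝ = 0 := by rw [hn, inner_symm_axis, h0]
        rw [real_inner_smul_left] at hcross
        rcases hμn with rfl | rfl
        · rw [hrn, mul_zero] at hcross; linarith
        · rw [inner_neg_right, hrn, neg_zero, mul_zero] at hcross; linarith

/-! ### The twin companion -/

/-- The last letters of two `Forall₂`-related words are related. -/
theorem last_rel_of_forall₂_concat {α β : List (EuclideanSpace ℝ (Fin 3))} {a b : EuclideanSpace ℝ (Fin 3)}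
    (h : List.Forall₂ (fun x y => x = y ∨ x = -y) (α ++ [a]) (β ++ [b])) : a = b ∨ a = -b := by
  have h' := List.forall₂_reverse_iff.2 h
  rw [List.reverse_append, List.reverse_append, List.reverse_singleton, List.reverse_singleton,
    List.singleton_append, List.singleton_append, List.forall₂_cons] at h'
  exact h'.1

/-- A word `Forall₂`-related to `κ ++ [e₃]` ends with `±e₃`; so it is not a nonempty-tailed word of letters `≠ ±e₃`. -/
theorem forall₂_concat_axis_false {κ : List (EuclideanSpace ℝ (Fin 3))} {l : List (EuclideanSpace ℝ (Fin 3))}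
    (hl : ∀ μ ∈ l, μ ≠ EuclideanSpace.single (2 : Fin 3) (1 : ℝ) ∧ μ ≠ -EuclideanSpace.single (2 : Fin 3) (1 : ℝ))
    (hne : l ≠ [])
    (h : List.Forall₂ (fun x y => x = y ∨ x = -y) (κ ++ [EuclideanSpace.single (2 : Fin 3) (1 : ℝ)]) l) : False := by
  rcases List.eq_nil_or_concat' l with rfl | ⟨L, b, rfl⟩
  · exact hne rfl
  · obtain ⟨h1, h2⟩ := hl b (by simp)
    rcases last_rel_of_forall₂_concat h with h | h
    · exact h1 h.symm
    · exact h2 (by rw [h, neg_neg])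

/-- Negating the argument does not change the slot-dozen image of a linear isometry. -/
theorem image_neg_comp_eq (G : EuclideanSpace ℝ (Fin 3) ≃ₗᵢ[ℝ] EuclideanSpace ℝ (Fin 3)) :
    (fun w => -G w) '' (↑fccSlots : Set (EuclideanSpace ℝ (Fin 3))) =
      (G : EuclideanSpace ℝ (Fin 3) → EuclideanSpace ℝ (Fin 3)) '' ↑fccSlots := by
  ext v
  constructor
  · rintro ⟨w, hw, rfl⟩
    exact ⟨-w, mem_coe.2 (neg_mem_fccSlots (mem_coe.1 hw)), by simp⟩
  · rintro ⟨w, hw, rfl⟩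
    exact ⟨-w, mem_coe.2 (neg_mem_fccSlots (mem_coe.1 hw)), by simp⟩

/-- **The half-turn companion reads the basal-mirrored words**: the class `κ` of the system with base frame
`H ≫ L′` (`H` the half-turn about `e₃`) has the slot dozen of the word `κ ++ [e₃]` of the system with base frame `L′`. -/
theorem image_fw_halfTurn (L' : EuclideanSpace ℝ (Fin 3) ≃ₗᵢ[ℝ] EuclideanSpace ℝ (Fin 3))
    (R₁ R₂ : Finset (EuclideanSpace ℝ (Fin 3))) {κ : List (EuclideanSpace ℝ (Fin 3))} (hunit : ∀ μ ∈ κ, ‖μ‖ = 1) :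
    ((⟨((ℝ ∙ EuclideanSpace.single (2 : Fin 3) (1 : ℝ)).reflection).trans L', R₂⟩ : PlateSystem).Fw κ :
        EuclideanSpace ℝ (Fin 3) → EuclideanSpace ℝ (Fin 3)) '' ↑fccSlots =
      ((⟨L', R₁⟩ : PlateSystem).Fw (κ ++ [EuclideanSpace.single (2 : Fin 3) (1 : ℝ)]) :
        EuclideanSpace ℝ (Fin 3) → EuclideanSpace ℝ (Fin 3)) '' ↑fccSlots := by
  have hunit' : ∀ μ ∈ κ ++ [EuclideanSpace.single (2 : Fin 3) (1 : ℝ)], ‖μ‖ = 1 := by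
    intro μ hμ
    rcases List.mem_append.1 hμ with h | h
    · exact hunit μ h
    · rw [List.mem_singleton.1 h, PiLp.norm_single, norm_one]
  have key : ∀ x : EuclideanSpace ℝ (Fin 3),
      ((⟨((ℝ ∙ EuclideanSpace.single (2 : Fin 3) (1 : ℝ)).reflection).trans L', R₂⟩ : PlateSystem).Fw κ) x =
        -((⟨L', R₁⟩ : PlateSystem).Fw (κ ++ [EuclideanSpace.single (2 : Fin 3) (1 : ℝ)])) x := by
    intro x
    rw [fw_apply_eq_foldl _ hunit, fw_apply_eq_foldl _ hunit', List.foldl_append, List.foldl_cons, List.foldl_nil]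
    change L' ((ℝ ∙ EuclideanSpace.single (2 : Fin 3) (1 : ℝ)).reflection _) = -L' _
    rw [← map_neg, ← basalMirror_apply_eq]
    congr 1
    change _ = -((ℝ ∙ EuclideanSpace.single (2 : Fin 3) (1 : ℝ))ᗮ.reflection _)
    rw [Submodule.reflection_orthogonal_apply, neg_neg]
  have hfun : ((⟨((ℝ ∙ EuclideanSpace.single (2 : Fin 3) (1 : ℝ)).reflection).trans L', R₂⟩ : PlateSystem).Fw κ :
      EuclideanSpace ℝ (Fin 3) → EuclideanSpace ℝ (Fin 3)) =
      fun w => -((⟨L', R₁⟩ : PlateSystem).Fw (κ ++ [EuclideanSpace.single (2 : Fin 3) (1 : ℝ)])) w :=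
    funext key
  rw [hfun]
  exact image_neg_comp_eq _

/-- **TWIN COLLAPSE.**  If both the system with base frame `L′` and its half-turn companion with base frame `H ≫ L′`
have a well-formed class over a BASAL root with a standard dozen, then both classes are ROOT classes, `L′` itself has a
standard dozen and `L′ e₃ = ±e₃`. -/
theorem twin_collapse (L' : EuclideanSpace ℝ (Fin 3) ≃ₗᵢ[ℝ] EuclideanSpace ℝ (Fin 3))
    (R₁ R₂ : Finset (EuclideanSpace ℝ (Fin 3)))
    {r₁ : EuclideanSpace ℝ (Fin 3)} (hr₁ : r₁ 2 = 0) {κ₁ : List (EuclideanSpace ℝ (Fin 3))} (hκ₁ : WFChain r₁ κ₁)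
    (hstd₁ : (((⟨L', R₁⟩ : PlateSystem).Fw κ₁ : EuclideanSpace ℝ (Fin 3) → EuclideanSpace ℝ (Fin 3)) '' ↑fccSlots =
        ↑fccSlots ∨
      ((⟨L', R₁⟩ : PlateSystem).Fw κ₁ : EuclideanSpace ℝ (Fin 3) → EuclideanSpace ℝ (Fin 3)) '' ↑fccSlots =
        (basalMirror : EuclideanSpace ℝ (Fin 3) → EuclideanSpace ℝ (Fin 3)) '' ↑fccSlots))
    {r₂ : EuclideanSpace ℝ (Fin 3)} (hr₂ : r₂ 2 = 0) {κ₂ : List (EuclideanSpace ℝ (Fin 3))} (hκ₂ : WFChain r₂ κ₂)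
    (hstd₂ : (((⟨((ℝ ∙ EuclideanSpace.single (2 : Fin 3) (1 : ℝ)).reflection).trans L', R₂⟩ : PlateSystem).Fw κ₂ :
          EuclideanSpace ℝ (Fin 3) → EuclideanSpace ℝ (Fin 3)) '' ↑fccSlots = ↑fccSlots ∨
      ((⟨((ℝ ∙ EuclideanSpace.single (2 : Fin 3) (1 : ℝ)).reflection).trans L', R₂⟩ : PlateSystem).Fw κ₂ :
          EuclideanSpace ℝ (Fin 3) → EuclideanSpace ℝ (Fin 3)) '' ↑fccSlots =
        (basalMirror : EuclideanSpace ℝ (Fin 3) → EuclideanSpace ℝ (Fin 3)) '' ↑fccSlots)) :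
    κ₁ = [] ∧ κ₂ = [] ∧
      ((L' : EuclideanSpace ℝ (Fin 3) → EuclideanSpace ℝ (Fin 3)) '' ↑fccSlots = ↑fccSlots ∨
        (L' : EuclideanSpace ℝ (Fin 3) → EuclideanSpace ℝ (Fin 3)) '' ↑fccSlots =
          (basalMirror : EuclideanSpace ℝ (Fin 3) → EuclideanSpace ℝ (Fin 3)) '' ↑fccSlots) ∧
      (L' (EuclideanSpace.single (2 : Fin 3) (1 : ℝ)) = EuclideanSpace.single (2 : Fin 3) (1 : ℝ) ∨
        L' (EuclideanSpace.single (2 : Fin 3) (1 : ℝ)) = -EuclideanSpace.single (2 : Fin 3) (1 : ℝ)) := by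
  set S₁ : PlateSystem := ⟨L', R₁⟩ with hS₁
  have he₃1 : ‖EuclideanSpace.single (2 : Fin 3) (1 : ℝ)‖ = 1 := by rw [PiLp.norm_single, norm_one]
  have he₃m : ∀ w ∈ fccSlots, ⟪w, EuclideanSpace.single (2 : Fin 3) (1 : ℝ)⟫_ℝ = 0 ∨
      ⟪w, EuclideanSpace.single (2 : Fin 3) (1 : ℝ)⟫_ℝ = Real.sqrt (2 / 3) ∨
      ⟪w, EuclideanSpace.single (2 : Fin 3) (1 : ℝ)⟫_ℝ = -Real.sqrt (2 / 3) := by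
    intro w hw; rw [inner_single_two_one]; exact slot_apply_two_cases hw
  obtain ⟨hlet₁, hch₁⟩ := wfChain_letters hκ₁
  obtain ⟨hlet₂, hch₂⟩ := wfChain_letters hκ₂
  have hunit₁ : ∀ μ ∈ κ₁, ‖μ‖ = 1 := fun μ hμ => (hlet₁ μ hμ).1
  have hunit₂ : ∀ μ ∈ κ₂, ‖μ‖ = 1 := fun μ hμ => (hlet₂ μ hμ).1
  have hax₁ : ∀ μ ∈ κ₁, μ ≠ EuclideanSpace.single (2 : Fin 3) (1 : ℝ) ∧ μ ≠ -EuclideanSpace.single (2 : Fin 3) (1 : ℝ) :=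
    fun μ hμ => wfChain_letter_ne_axis hr₁ hκ₁ hμ
  -- the companion class reads the word `κ₂ ++ [e₃]` of `S₁`
  rw [image_fw_halfTurn L' R₁ R₂ hunit₂] at hstd₂
  have hlet₂' : ∀ μ ∈ κ₂ ++ [EuclideanSpace.single (2 : Fin 3) (1 : ℝ)], ‖μ‖ = 1 ∧
      ∀ w ∈ fccSlots, ⟪w, μ⟫_ℝ = 0 ∨ ⟪w, μ⟫_ℝ = Real.sqrt (2 / 3) ∨ ⟪w, μ⟫_ℝ = -Real.sqrt (2 / 3) := by
    intro μ hμ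
    rcases List.mem_append.1 hμ with h | h
    · exact hlet₂ μ h
    · rw [List.mem_singleton.1 h]; exact ⟨he₃1, he₃m⟩
  have hunit₂' : ∀ μ ∈ κ₂ ++ [EuclideanSpace.single (2 : Fin 3) (1 : ℝ)], ‖μ‖ = 1 := fun μ hμ => (hlet₂' μ hμ).1
  have hch₂' : List.IsChain (fun μ μ' => ⟪μ, μ'⟫_ℝ = 1 / 3 ∨ ⟪μ, μ'⟫_ℝ = -1 / 3)
      (κ₂ ++ [EuclideanSpace.single (2 : Fin 3) (1 : ℝ)]) := by
    -- reversed, this is «prepend `e₃` to `κ₂.reverse`», and `e₃` is not `±` any letter of `κ₂`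
    rw [← List.isChain_reverse, List.reverse_append, List.reverse_singleton, List.singleton_append]
    have hlet₂r : ∀ μ ∈ κ₂.reverse, ‖μ‖ = 1 ∧
        ∀ w ∈ fccSlots, ⟪w, μ⟫_ℝ = 0 ∨ ⟪w, μ⟫_ℝ = Real.sqrt (2 / 3) ∨ ⟪w, μ⟫_ℝ = -Real.sqrt (2 / 3) :=
      fun μ hμ => hlet₂ μ (List.mem_reverse.1 hμ)
    have hch₂r : List.IsChain (fun μ μ' => ⟪μ, μ'⟫_ℝ = 1 / 3 ∨ ⟪μ, μ'⟫_ℝ = -1 / 3) κ₂.reverse := by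
      rw [List.isChain_reverse]; exact hch₂.imp fun a b h => by rw [real_inner_comm]; exact h
    have key := isChain_cons_of_ne ⟨he₃1, he₃m⟩ hlet₂r hch₂r fun μ hμ => by
      have hμκ : μ ∈ κ₂ := List.mem_reverse.1 (List.mem_of_mem_head? hμ)
      obtain ⟨h1, h2⟩ := wfChain_letter_ne_axis hr₂ hκ₂ hμκ
      refine ⟨fun h => h1 h.symm, fun h => h2 ?_⟩
      rw [h, neg_neg]
    exact key.imp fun a b h => by rw [real_inner_comm]; exact h
  rcases std_cases hstd₁ hstd₂ with hI | hII
  · -- same dozen as `κ₁`: then `κ₁` would end with `±e₃`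
    exfalso
    have hF2 := reduced_forall₂_of_foldl_image_eq _ _ hlet₂' hlet₁ hch₂' hch₁
      (foldl_image_eq_of_image_fw_eq S₁ hunit₂' hunit₁ hI)
    refine forall₂_concat_axis_false hax₁ ?_ hF2
    intro h0; rw [h0] at hF2; exact absurd hF2.length_eq (by simp)
  · rw [image_basalMirror_fw S₁ κ₁] at hII
    have hnm := symm_axis_menu hstd₁
    have hletn : ∀ μ ∈ (S₁.Fw κ₁).symm (EuclideanSpace.single (2 : Fin 3) (1 : ℝ)) :: κ₁, ‖μ‖ = 1 ∧
        ∀ w ∈ fccSlots, ⟪w, μ⟫_ℝ = 0 ∨ ⟪w, μ⟫_ℝ = Real.sqrt (2 / 3) ∨ ⟪w, μ⟫_ℝ = -Real.sqrt (2 / 3) := by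
      intro μ hμ
      rcases List.mem_cons.1 hμ with rfl | hμ
      · exact hnm
      · exact hlet₁ μ hμ
    have hunitn : ∀ μ ∈ (S₁.Fw κ₁).symm (EuclideanSpace.single (2 : Fin 3) (1 : ℝ)) :: κ₁, ‖μ‖ = 1 :=
      fun μ hμ => (hletn μ hμ).1
    by_cases hdeg : ∃ μ, κ₁.head? = some μ ∧ ((S₁.Fw κ₁).symm (EuclideanSpace.single (2 : Fin 3) (1 : ℝ)) = μ ∨
        (S₁.Fw κ₁).symm (EuclideanSpace.single (2 : Fin 3) (1 : ℝ)) = -μ)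
    · exfalso
      obtain ⟨μ, hμ, hsign⟩ := hdeg
      obtain ⟨κ₁', rfl⟩ : ∃ κ₁', κ₁ = μ :: κ₁' := by
        cases κ₁ with
        | nil => simp at hμ
        | cons a l => simp at hμ; exact ⟨l, by rw [hμ]⟩
      have hμ1 : ‖μ‖ = 1 := hunit₁ μ (by simp)
      rw [fw_cons_cons_of_sign S₁ κ₁' hsign hμ1] at hII
      have hlet₁' : ∀ ν ∈ κ₁', ‖ν‖ = 1 ∧
          ∀ w ∈ fccSlots, ⟪w, ν⟫_ℝ = 0 ∨ ⟪w, ν⟫_ℝ = Real.sqrt (2 / 3) ∨ ⟪w, ν⟫_ℝ = -Real.sqrt (2 / 3) :=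
        fun ν hν => hlet₁ ν (by simp [hν])
      have hunit₁' : ∀ ν ∈ κ₁', ‖ν‖ = 1 := fun ν hν => (hlet₁' ν hν).1
      have hch₁' : List.IsChain (fun μ μ' => ⟪μ, μ'⟫_ℝ = 1 / 3 ∨ ⟪μ, μ'⟫_ℝ = -1 / 3) κ₁' := by
        rw [List.isChain_cons] at hch₁; exact hch₁.2
      have hF2 := reduced_forall₂_of_foldl_image_eq _ _ hlet₂' hlet₁' hch₂' hch₁'
        (foldl_image_eq_of_image_fw_eq S₁ hunit₂' hunit₁' hII)
      refine forall₂_concat_axis_false (fun ν hν => hax₁ ν (by simp [hν])) ?_ hF2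
      intro h0; rw [h0] at hF2; exact absurd hF2.length_eq (by simp)
    · push Not at hdeg
      have hchn : List.IsChain (fun μ μ' => ⟪μ, μ'⟫_ℝ = 1 / 3 ∨ ⟪μ, μ'⟫_ℝ = -1 / 3)
          ((S₁.Fw κ₁).symm (EuclideanSpace.single (2 : Fin 3) (1 : ℝ)) :: κ₁) :=
        isChain_cons_of_ne hnm hlet₁ hch₁ fun μ hμ => hdeg μ hμ
      have hF2 := reduced_forall₂_of_foldl_image_eq _ _ hlet₂' hletn hch₂' hchn
        (foldl_image_eq_of_image_fw_eq S₁ hunit₂' hunitn hII)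
      -- `κ₁` must be empty (else the related word `n :: κ₁` ends with a letter of `κ₁`, which would be `±e₃`)
      rcases List.eq_nil_or_concat' κ₁ with hκ₁e | ⟨L, b, hκ₁e⟩
      swap
      · exfalso
        rw [hκ₁e, ← List.cons_append] at hF2
        obtain ⟨h1, h2⟩ := hax₁ b (by rw [hκ₁e]; simp)
        rcases last_rel_of_forall₂_concat hF2 with h | h
        · exact h1 h.symm
        · exact h2 (by rw [h, neg_neg])
      subst hκ₁e
      have hlen := hF2.length_eq
      simp only [List.length_append, List.length_cons, List.length_nil] at hlen
      have hκ₂e : κ₂ = [] := List.length_eq_zero_iff.1 (by omega)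
      subst hκ₂e
      rw [List.nil_append, List.forall₂_cons] at hF2
      refine ⟨rfl, rfl, hstd₁, ?_⟩
      -- `e₃ = ±L⁻¹ e₃`
      have hFw0 : S₁.Fw [] = L' := rfl
      rw [hFw0] at hF2
      rcases hF2.1 with h | h
      · left
        have := congrArg L' h
        rw [LinearIsometryEquiv.apply_symm_apply] at this
        exact this
      · right
        have := congrArg L' h
        rw [map_neg, LinearIsometryEquiv.apply_symm_apply] at this
        exact this

end Collapse
end Summit.Ventures.Crystal3D.Theorems

end
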